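import Summits.AtomisticToContinuum.Crystallization.Theorems.FreeSplittingCertificatesStrictSplittingRuleCoreJointDefs
import Summits.AtomisticToContinuum.Crystallization.Theorems.FreeSplittingCertificatesStrictSplittingRuleCoreFirstOrderDesignGeometry

/-!
# `StrictSplittingRule` (stmt-AtomisticToContinuum-12560): every first-order design has UNBOUNDED range

Route `FreeSplittingCertificates`, crux r3 `StrictSplittingRule`, line `registered` (unit b2b-freesplit-B, gen 4).
H1 (`CoreFirstOrderDesign`, …CoreDefs.lean) and the joint certificate H12⋆ (`CoreJointCoercive`, …CoreJointDefs.lean)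
ask for Bravais-covariant first-order transfer coefficients `β (b p) (q − p) s` such that, for every finitely supported
displacement field `u` and every site `p`, the naive half-split first variation plus the antisymmetrised stencil
transfers vanishes.  Tested against the field displacing ONE far site `q` (every such field is finitely supported),
the identity at `p` reads `W′(‖y_q − y_p‖²)·⟪y_q − y_p, v⟫ + (β-terms at offsets p − q and p − q + s) = 0`; if the
coefficients vanished beyond some distance `R₀`, this would force `W′(‖y_q − y_p‖²) = 0`, i.e. `‖y_q − y_p‖ = 1`, at
every far site `q` — absurd along an index line.  Hence NO first-order design (in particular the `β` of no witness of
H12⋆) is finitely supported in the offset: any certificate of the registered core is an infinite-range object and any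
proof must control infinite-range sums (the landed line truss, …CoreFirstOrderDesignTruss.lean, decays like `r⁻⁶`).
Structural bookkeeping, [folklore]; nothing here is summit progress.
-/

noncomputable section

namespace Summit.AtomisticToContinuum.Crystallization.Theorems.StrictSplittingRuleBirth

open scoped BigOperators Classical
open Literature.MathematicalPhysics.StatisticalMechanics
open Literature.Geometry.DiscreteGeometry
open Summit.AtomisticToContinuum.Crystallization.Theorems.PalmUnimodularRigidity.LayeredLawsSelectHcp
  (hcpSite ljSqDeriv hcpSite_zero)

/-- `W′(σ) = ½(σ⁻⁴ − σ⁻⁷)` vanishes at a positive squared length only at `σ = 1`. [folklore] -/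
theorem ljSqDeriv_eq_zero_iff {σ : ℝ} (hσ : 0 < σ) : ljSqDeriv σ = 0 ↔ σ = 1 := by
  unfold ljSqDeriv
  constructor
  · intro h0
    have ht : 0 < σ⁻¹ := inv_pos.2 hσ
    have h1 : (σ⁻¹) ^ 4 * (1 - (σ⁻¹) ^ 3) = 0 := by nlinarith [h0]
    rcases mul_eq_zero.1 h1 with h2 | h2
    · exact absurd h2 (pow_ne_zero 4 ht.ne')
    · have h3 : (σ⁻¹) ^ 3 = 1 := by linarith
      have h4 : σ⁻¹ = 1 := (pow_eq_one_iff_of_nonneg ht.le (by norm_num)).1 h3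
      exact inv_eq_one.1 h4
  · rintro rfl
    norm_num

/-- The site `(0, n, 0)` sits at `n • y_{(0,1,0)}`, at distance `n·a` from the root for `0 ≤ n`, `0 < a`. [folklore] -/
theorem hcpSite_line_n (a h : ℝ) (n : ℤ) :
    hcpSite a h ((0 : ℤ), n, (0 : ℤ)) = (n : ℝ) • hcpSite a h ((0 : ℤ), (1 : ℤ), (0 : ℤ)) := by
  have hl := h1_line a h (s := ((0 : ℤ), (1 : ℤ), (0 : ℤ))) (by simp) 0 n
  have e : (0 : ℤ × ℤ × ℤ) + n • ((0 : ℤ), (1 : ℤ), (0 : ℤ)) = ((0 : ℤ), n, (0 : ℤ)) := by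
    ext <;> simp
  rw [e, hcpSite_zero, zero_add] at hl
  exact hl

/-- `‖y_{(0,n,0)}‖ = n·a` for `0 ≤ n` and `0 < a`. [folklore] -/
theorem norm_hcpSite_line_n {a : ℝ} (h : ℝ) (ha : 0 < a) {n : ℤ} (hn : 0 ≤ n) :
    ‖hcpSite a h ((0 : ℤ), n, (0 : ℤ))‖ = n * a := by
  have hsq := h1_stencil_norm_sq a h (s := ((0 : ℤ), (1 : ℤ), (0 : ℤ))) (by simp)
  rw [if_pos rfl] at hsq
  have hnorm : ‖hcpSite a h ((0 : ℤ), (1 : ℤ), (0 : ℤ))‖ = a := by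
    have h0 : 0 ≤ ‖hcpSite a h ((0 : ℤ), (1 : ℤ), (0 : ℤ))‖ := norm_nonneg _
    nlinarith [hsq, ha]
  rw [hcpSite_line_n, norm_smul, hnorm, Real.norm_eq_abs, ← Int.cast_abs, abs_of_nonneg hn]

/-- **No first-order design has bounded range.**  If Bravais-covariant coefficients `β` (any stencil `Y`) satisfy
H1's identity at every site for every finitely supported field, then for every `R₀` some coefficient
`β (b p) (q − p) s` with `‖y_q − y_p‖ > R₀` is nonzero.  Proof: test the identity at `p = 0` against the field
displacing only the far site `q = (0, n, 0)` — it reduces to `W′(n²a²)·n²a² = 0` once all far coefficients vanish,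
so `n·a = 1`; do it for `n` and `n + 1`. [folklore] -/
theorem exists_far_coeff_ne_zero_of_firstOrderIdentity {a h : ℝ} (ha : 0 < a) {Y : Finset (ℤ × ℤ × ℤ)}
    {β : Bool → (ℤ × ℤ × ℤ) → (ℤ × ℤ × ℤ) → ℝ}
    (hid : ∀ u : ℤ × ℤ × ℤ → EuclideanSpace ℝ (Fin 3), (Function.support u).Finite → ∀ p : ℤ × ℤ × ℤ,
      (∑' q : ℤ × ℤ × ℤ, (if q = p then (0 : ℝ) else
          ljSqDeriv (‖hcpSite a h q - hcpSite a h p‖ ^ 2) *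
            inner ℝ (hcpSite a h q - hcpSite a h p) (u q - u p))) +
      (∑' q : ℤ × ℤ × ℤ, (if q = p then (0 : ℝ) else
          ∑ s ∈ Y, (β (decide (Even p.1)) (q - p) s *
              inner ℝ (hcpSite a h (p + s) - hcpSite a h p) (u (p + s) - u p) -
            β (decide (Even q.1)) (p - q) s *
              inner ℝ (hcpSite a h (q + s) - hcpSite a h q) (u (q + s) - u q)))) = 0)
    (R₀ : ℝ) :
    ∃ p q : ℤ × ℤ × ℤ, ∃ s ∈ Y, R₀ < ‖hcpSite a h q - hcpSite a h p‖ ∧ β (decide (Even p.1)) (q - p) s ≠ 0 := by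
  by_contra hcon
  push Not at hcon
  -- hcon : ∀ p q, ∀ s ∈ Y, R₀ < ‖y_q − y_p‖ → β (b p) (q − p) s = 0
  -- a bound S on the stencil bond lengths seen from either parity, and an index bound on Y along the line
  set S : ℝ := ∑ s ∈ Y, (‖hcpSite a h s‖ + ‖hcpSite a h (-s)‖) with hS
  have hS0 : 0 ≤ S := Finset.sum_nonneg fun s _ => by positivity
  have hSge : ∀ s ∈ Y, ‖hcpSite a h s‖ ≤ S ∧ ‖hcpSite a h (-s)‖ ≤ S := by
    intro s hs
    have := Finset.single_le_sum (f := fun s => ‖hcpSite a h s‖ + ‖hcpSite a h (-s)‖)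
      (fun s _ => by positivity) hs
    exact ⟨by linarith [norm_nonneg (hcpSite a h (-s))], by linarith [norm_nonneg (hcpSite a h s)]⟩
  set K : ℕ := Y.sup fun s => s.2.1.natAbs with hK
  have hKY : ∀ n : ℤ, (K : ℤ) < n → ((0 : ℤ), n, (0 : ℤ)) ∉ Y := by
    intro n hn hmem
    have h1 : ((0 : ℤ), n, (0 : ℤ)).2.1.natAbs ≤ K := Finset.le_sup (f := fun s => s.2.1.natAbs) hmem
    simp only at h1
    omega
  -- the key consequence of the identity for ONE far index n
  have key : ∀ n : ℤ, (K : ℤ) < n → (R₀ + S) / a < n → 0 < n → (n : ℝ) * a = 1 := by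
    intro n hnK hnR hn0
    have hn0' : (0 : ℝ) < n := by exact_mod_cast hn0
    have hna : R₀ + S < n * a := by rwa [div_lt_iff₀ ha] at hnR
    set q : ℤ × ℤ × ℤ := ((0 : ℤ), n, (0 : ℤ)) with hq
    set v : EuclideanSpace ℝ (Fin 3) := hcpSite a h q with hv
    have hq0 : q ≠ 0 := by
      intro h0
      have : n = 0 := by simpa [hq, Prod.ext_iff] using h0
      omega
    have hnormq : ‖hcpSite a h q‖ = n * a := norm_hcpSite_line_n h ha hn0.le
    -- the test field
    set u : ℤ × ℤ × ℤ → EuclideanSpace ℝ (Fin 3) := fun x => if x = q then v else 0 with hu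
    have hu_fin : (Function.support u).Finite := by
      refine (Set.finite_singleton q).subset fun x hx => ?_
      rw [Set.mem_singleton_iff]
      by_contra hxq
      exact hx (if_neg hxq)
    have huq : u q = v := by simp [hu]
    have hune : ∀ x, x ≠ q → u x = 0 := fun x hx => by simp [hu, hx]
    have hu0 : u 0 = 0 := hune 0 (Ne.symm hq0)
    -- far coefficients vanish at the sites x = q and x = q - s
    have hfar_q : ∀ s ∈ Y, β (decide (Even q.1)) (0 - q) s = 0 := by
      intro s hs
      refine hcon q 0 s hs ?_
      rw [hcpSite_zero, zero_sub, norm_neg, hnormq]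
      linarith
    have hfar_qs : ∀ s ∈ Y, β (decide (Even (q - s).1)) (0 - (q - s)) s = 0 := by
      intro s hs
      refine hcon (q - s) 0 s hs ?_
      rw [hcpSite_zero, zero_sub, norm_neg]
      -- ‖y_{q-s}‖ ≥ ‖y_q‖ − ‖y_q − y_{q−s}‖ ≥ n a − S
      have hdiff : ‖hcpSite a h q - hcpSite a h (q - s)‖ ≤ S := by
        have e := h1_sub_eq a h (q - s) s
        rw [sub_add_cancel] at e
        rw [e]
        split_ifs with hev
        · exact (hSge s hs).1
        · rw [norm_neg]; exact (hSge s hs).2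
      have htri : ‖hcpSite a h q‖ ≤ ‖hcpSite a h q - hcpSite a h (q - s)‖ + ‖hcpSite a h (q - s)‖ :=
        norm_le_norm_sub_add _ _
      linarith
    -- evaluate the identity at p = 0
    have hI := hid u hu_fin 0
    have hsum2 : (fun x : ℤ × ℤ × ℤ => (if x = 0 then (0 : ℝ) else
        ∑ s ∈ Y, (β (decide (Even (0 : ℤ × ℤ × ℤ).1)) (x - 0) s *
            inner ℝ (hcpSite a h (0 + s) - hcpSite a h 0) (u (0 + s) - u 0) -
          β (decide (Even x.1)) (0 - x) s *
            inner ℝ (hcpSite a h (x + s) - hcpSite a h x) (u (x + s) - u x)))) = fun _ => 0 := by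
      funext x
      split_ifs with hx
      · rfl
      refine Finset.sum_eq_zero fun s hs => ?_
      have hA : u (0 + s) - u 0 = 0 := by
        rw [zero_add, hu0, sub_zero]
        refine hune s fun hsq => ?_
        rw [hsq, hq] at hs
        exact hKY n hnK hs
      rw [hA, inner_zero_right, mul_zero, zero_sub, neg_eq_zero]
      by_cases hxq : x = q
      · subst hxq; rw [hfar_q s hs, zero_mul]
      by_cases hxs : x + s = q
      · have : x = q - s := by rw [← hxs, add_sub_cancel_right]
        subst this; rw [hfar_qs s hs, zero_mul]
      · rw [hune x hxq, hune (x + s) hxs, sub_zero, inner_zero_right, mul_zero]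
    have hsum1 : (fun x : ℤ × ℤ × ℤ => (if x = 0 then (0 : ℝ) else
        ljSqDeriv (‖hcpSite a h x - hcpSite a h 0‖ ^ 2) * inner ℝ (hcpSite a h x - hcpSite a h 0) (u x - u 0))) =
        fun x => if x = q then ljSqDeriv (‖hcpSite a h q‖ ^ 2) * inner ℝ (hcpSite a h q) v else 0 := by
      funext x
      by_cases hxq : x = q
      · subst hxq
        rw [if_neg hq0, if_pos rfl, hcpSite_zero, sub_zero, huq, hu0, sub_zero]
      · rw [if_neg hxq]
        split_ifs with hx0
        · rfl
        · rw [hune x hxq, hu0, sub_zero, inner_zero_right, mul_zero]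
    rw [hsum2, tsum_zero, add_zero, hsum1, tsum_ite_eq] at hI
    -- hI : W′(‖y_q‖²) · ⟪y_q, y_q⟫ = 0
    rw [hv, real_inner_self_eq_norm_sq, hnormq] at hI
    have hpos : 0 < ((n : ℝ) * a) ^ 2 := by positivity
    rcases mul_eq_zero.1 hI with h0 | h0
    · have h1 : ((n : ℝ) * a) ^ 2 = 1 := (ljSqDeriv_eq_zero_iff hpos).1 h0
      have h2 : 0 < (n : ℝ) * a := by positivity
      nlinarith
    · exact absurd h0 hpos.ne'
  -- two consecutive far indices give n·a = 1 = (n+1)·a, absurd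
  obtain ⟨N, hN⟩ : ∃ N : ℕ, max ((K : ℝ) + 1) ((R₀ + S) / a + 1) ≤ N := exists_nat_ge _
  have hN1 : (K : ℤ) < (N : ℤ) := by
    have : (K : ℝ) + 1 ≤ N := le_trans (le_max_left _ _) hN
    exact_mod_cast (by linarith : (K : ℝ) < N)
  have hN2 : (R₀ + S) / a < (N : ℤ) := by
    have : (R₀ + S) / a + 1 ≤ N := le_trans (le_max_right _ _) hN
    push_cast; linarith
  have hN0 : (0 : ℤ) < N := by omega
  have e1 := key N hN1 hN2 hN0
  have e2 := key (N + 1) (by omega) (by push_cast at hN2 ⊢; linarith) (by omega)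
  push_cast at e1 e2
  nlinarith

/-- **Corollary for H1**: the first-order design of `CoreFirstOrderDesign a h` is never finitely supported in the
offset — for every `R₀` a coefficient beyond distance `R₀` is nonzero. [folklore] -/
theorem coreFirstOrderDesign_unbounded_range {a h : ℝ} (ha : 0 < a) (hH1 : CoreFirstOrderDesign a h) :
    ∃ (Y : Finset (ℤ × ℤ × ℤ)) (β : Bool → (ℤ × ℤ × ℤ) → (ℤ × ℤ × ℤ) → ℝ) (C : ℝ),
      (∀ b d s, s ∉ Y → β b d s = 0) ∧
      (∀ p q : ℤ × ℤ × ℤ, ∀ s, |β (decide (Even p.1)) (q - p) s| ≤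
          C * ((1 + ‖hcpSite a h q - hcpSite a h p‖)⁻¹) ^ 6) ∧
      (∀ u : ℤ × ℤ × ℤ → EuclideanSpace ℝ (Fin 3), (Function.support u).Finite → ∀ p : ℤ × ℤ × ℤ,
        (∑' q : ℤ × ℤ × ℤ, (if q = p then (0 : ℝ) else
            ljSqDeriv (‖hcpSite a h q - hcpSite a h p‖ ^ 2) *
              inner ℝ (hcpSite a h q - hcpSite a h p) (u q - u p))) +
        (∑' q : ℤ × ℤ × ℤ, (if q = p then (0 : ℝ) else
            ∑ s ∈ Y, (β (decide (Even p.1)) (q - p) s *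
                inner ℝ (hcpSite a h (p + s) - hcpSite a h p) (u (p + s) - u p) -
              β (decide (Even q.1)) (p - q) s *
                inner ℝ (hcpSite a h (q + s) - hcpSite a h q) (u (q + s) - u q)))) = 0) ∧
      ∀ R₀ : ℝ, ∃ p q : ℤ × ℤ × ℤ, ∃ s ∈ Y,
        R₀ < ‖hcpSite a h q - hcpSite a h p‖ ∧ β (decide (Even p.1)) (q - p) s ≠ 0 := by
  obtain ⟨Y, β, C, hY, hdec, hid⟩ := hH1
  exact ⟨Y, β, C, hY, hdec, hid, fun R₀ => exists_far_coeff_ne_zero_of_firstOrderIdentity ha hid R₀⟩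

/-- **Corollary for H12⋆**: the first-order design `β` of any witness of the joint certificate
`CoreJointCoercive a h κ₁ κ₃` has unbounded range (via `coreFirstOrderDesign_of_joint`): no finitely supported table
witnesses the registered core, at any constants. [folklore] -/
theorem coreJointCoercive_unbounded_range {a h κ₁ κ₃ : ℝ} (ha : 0 < a) (hJ : CoreJointCoercive a h κ₁ κ₃) :
    ∃ (Y : Finset (ℤ × ℤ × ℤ)) (β : Bool → (ℤ × ℤ × ℤ) → (ℤ × ℤ × ℤ) → ℝ) (C : ℝ),
      (∀ b d s, s ∉ Y → β b d s = 0) ∧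
      (∀ p q : ℤ × ℤ × ℤ, ∀ s, |β (decide (Even p.1)) (q - p) s| ≤
          C * ((1 + ‖hcpSite a h q - hcpSite a h p‖)⁻¹) ^ 6) ∧
      (∀ u : ℤ × ℤ × ℤ → EuclideanSpace ℝ (Fin 3), (Function.support u).Finite → ∀ p : ℤ × ℤ × ℤ,
        (∑' q : ℤ × ℤ × ℤ, (if q = p then (0 : ℝ) else
            ljSqDeriv (‖hcpSite a h q - hcpSite a h p‖ ^ 2) *
              inner ℝ (hcpSite a h q - hcpSite a h p) (u q - u p))) +
        (∑' q : ℤ × ℤ × ℤ, (if q = p then (0 : ℝ) else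
            ∑ s ∈ Y, (β (decide (Even p.1)) (q - p) s *
                inner ℝ (hcpSite a h (p + s) - hcpSite a h p) (u (p + s) - u p) -
              β (decide (Even q.1)) (p - q) s *
                inner ℝ (hcpSite a h (q + s) - hcpSite a h q) (u (q + s) - u q)))) = 0) ∧
      ∀ R₀ : ℝ, ∃ p q : ℤ × ℤ × ℤ, ∃ s ∈ Y,
        R₀ < ‖hcpSite a h q - hcpSite a h p‖ ∧ β (decide (Even p.1)) (q - p) s ≠ 0 :=
  coreFirstOrderDesign_unbounded_range ha (coreFirstOrderDesign_of_joint hJ)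

end Summit.AtomisticToContinuum.Crystallization.Theorems.StrictSplittingRuleBirth

end
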